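import Summits.AtomisticToContinuum.HydrodynamicLimit.Theorems.OneFlightGossipEngineEnergyCurrentTailsGainCeilingRung0
import Summits.AtomisticToContinuum.HydrodynamicLimit.Theorems.OneFlightGossipEngineEnergyCurrentTailsEquilibrium
import HarnessLib

/-!
# Crux `EnergyCurrentTails` (stmt-AtomisticToContinuum-9235), line `quartic-schur-ledger`:
# rung-0 certificate of stub S2a `stub_energyFluxCeiling` (the energy-weighted flux ceiling)

At global equilibrium with drift (`G_N = localGibbsLaw σ a u θ̄`, constant profiles) the reshaped
open stub S2a of the line holds for ALL `N ≥ 1` and ALL windows `s ≤ s′`, with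
`K₀ = 16 · ∫‖w−v‖(‖v‖²+‖w‖²)²/4 dN(u,θ̄)^{⊗2} / (E‖w‖² · E‖w‖³)`:
`E[(N+1)⁻¹ Σ_{ordered records in (s,s′]} ‖v₁⁻‖²‖v₂⁻‖²] ≤ K₀ σ²(N+1)^{1/3}(s′−s) · sup m₂ · sup m₃`
(`stub_energyFluxCeilingRung0`).  Ingredients: `‖v₁⁻‖²‖v₂⁻‖² ≤ (‖v₁⁺‖²+‖v₂⁺‖²)²/4` by pair energy
conservation (`ofReal_energyFluxSum_le_collisionPairSum`, window shift along the orbit of `Φ_s z`),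
the LANDED expectation-form collision-flux engine `localGibbsLaw_lintegral_le_of_le_collisionMarkSum`
(p98294), and the constancy of the particle-averaged moments at rung 0
(`avgMoment_flow_localGibbsLaw_drift`: one-body marginal with drift `lintegral_vel_localGibbsLaw_drift` +
stationarity `lintegral_comp_flow_localGibbsLaw_const`).  The `N`-scaling is exact:
`(N+1)⁻¹ · 16 h (N+1)² ε_N² = 16 σ² (N+1)^{1/3} h`.

References: Cercignani–Illner–Pulvirenti 1994 App. 4.A (collision flux through contact cylinders);
Spohn 1991 Part I §2.3.
-/

noncomputable section

open MeasureTheory Set Filter Topology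
open scoped ENNReal

namespace Summit.AtomisticToContinuum.HydrodynamicLimit.Theorems.QuarticSchurLedger

open Literature.MathematicalPhysics.KineticTheory Literature.Analysis.FluidPDE
open Literature.Analysis.FunctionSpaces

/-! ### One-body velocity marginals with drift (rung-0 toolkit) -/

/-- **One-body velocity marginal of the homogeneous Gibbs law with drift.**  Under
`localGibbsLaw σ a u θ̄` (constant activity `a > 0`, constant drift `u`, constant temperature
`θ̄ > 0`, `σ ≤ 1/2`) the velocity of particle `i` is `N(u, θ̄ I₃)`-distributed: one-body velocity
expectations are `gaussMeasure u θ̄` expectations (disintegration `lintegral_localGibbsMeasure`,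
`lintegral_posWeight_eq_one`). [folklore] -/
theorem lintegral_vel_localGibbsLaw_drift {σ : ℝ} (hσ : σ ≤ 1 / 2) {a θb : ℝ} (ha : 0 < a)
    (hθ : 0 < θb) (u : V3) (N : ℕ)
    (Φ : HardSphereFlow (Torus.geometry (Fin 3)) (hsDiameter σ N) (N + 1))
    (i : Fin (N + 1)) {H : V3 → ℝ≥0∞} (hH : Measurable H) :
    ∫⁻ z, H ((z i).2) ∂(localGibbsLaw σ (fun _ => a) (fun _ => u) (fun _ => θb) N Φ) =
      ∫⁻ w, H w ∂(gaussMeasure u θb) := by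
  have hac : Continuous fun _ : T3 => a := continuous_const
  have hu : Continuous fun _ : T3 => u := continuous_const
  have hθc : Continuous fun _ : T3 => θb := continuous_const
  haveI := isProbabilityMeasure_localGibbsMeasure (u₀ := fun _ => u) hac hθc hu
    (fun _ => ha) (fun _ => hθ) hσ N
  have hGm : Measurable fun z : Config (N + 1) (Fin 3) T3 => H ((z i).2) :=
    hH.comp (measurable_pi_apply i).snd
  rw [localGibbsLaw_eq, lintegral_localGibbsMeasure hac hθc hu (fun _ => ha.le) (fun _ => hθ) σ N hGm]
  have hinner : ∀ x : Fin (N + 1) → T3,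
      ∫⁻ v, H ((zipConfig (x, v) i).2) ∂velMeasure (fun _ => u) (fun _ => θb) x =
        ∫⁻ w, H w ∂(gaussMeasure u θb) := by
    intro x
    simp only [zipConfig_apply]
    unfold velMeasure
    exact (measurePreserving_eval (fun j : Fin (N + 1) =>
      gaussMeasure ((fun _ : T3 => u) (x j)) ((fun _ : T3 => θb) (x j))) i).lintegral_comp hH
  simp_rw [hinner]
  have hfm : Measurable fun x : Fin (N + 1) → T3 => ENNReal.ofReal
      ((canonicalPartition (Torus.geometry (Fin 3)) (hsDiameter σ N) (N + 1)
        (localGibbsProfile (fun _ => a) (fun _ => u) (fun _ => θb)))⁻¹ *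
          posWeight (fun _ => a) (hsDiameter σ N) (N + 1) x) :=
    ((measurable_posWeight hac _ _).const_mul _).ennreal_ofReal
  rw [lintegral_mul_const _ hfm, lintegral_posWeight_eq_one hac hθc hu (fun _ => ha.le)
    (fun _ => hθ) σ N, one_mul]

/-- **Particle-averaged velocity moments are constant at rung 0.**  For constant profiles
`(a, u, θ̄)`, every flow `Φ`, every `N`, every time `r` and every measurable `H : V3 → ℝ≥0∞`:
`∫ (N+1)⁻¹ Σᵢ H(vᵢ(r)) dG_N = ∫ H dN(u, θ̄ I₃)` — stationarity of the homogeneous Gibbs law under the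
flow (`lintegral_comp_flow_localGibbsLaw_const`) and the one-body marginal. Stated for real-valued
`h ≥ 0` inside `ENNReal.ofReal ((N+1)⁻¹ * Σᵢ h(vᵢ))`, the shape of the line's moments `m_k`. [folklore] -/
theorem avgMoment_flow_localGibbsLaw_drift {σ : ℝ} (hσ : σ ≤ 1 / 2) {a θb : ℝ} (ha : 0 < a)
    (hθ : 0 < θb) (u : V3) (N : ℕ)
    (Φ : HardSphereFlow (Torus.geometry (Fin 3)) (hsDiameter σ N) (N + 1)) (r : ℝ)
    {h : V3 → ℝ} (hh : Measurable h) (h0 : ∀ w, 0 ≤ h w) :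
    ∫⁻ z, ENNReal.ofReal (((N : ℝ) + 1)⁻¹ * ∑ i : Fin (N + 1), h ((Φ.flow r z i).2))
        ∂(localGibbsLaw σ (fun _ => a) (fun _ => u) (fun _ => θb) N Φ) =
      ∫⁻ w, ENNReal.ofReal (h w) ∂(gaussMeasure u θb) := by
  have hg : Measurable fun w : V3 => ENNReal.ofReal (h w) := hh.ennreal_ofReal
  have hvel : ∀ i : Fin (N + 1), Measurable fun w : Config (N + 1) (Fin 3) T3 =>
      ENNReal.ofReal (h ((w i).2)) := fun i => hg.comp (measurable_pi_apply i).snd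
  set g : Config (N + 1) (Fin 3) T3 → ℝ≥0∞ := fun w =>
    ENNReal.ofReal (((N : ℝ) + 1)⁻¹ * ∑ i : Fin (N + 1), h ((w i).2)) with hgdef
  have hpt : ∀ w : Config (N + 1) (Fin 3) T3, g w =
      ENNReal.ofReal (((N : ℝ) + 1)⁻¹) * ∑ i : Fin (N + 1), ENNReal.ofReal (h ((w i).2)) := by
    intro w
    rw [hgdef]
    dsimp only
    rw [ENNReal.ofReal_mul (by positivity), ENNReal.ofReal_sum_of_nonneg fun i _ => h0 _]
  have hgm : Measurable g :=
    ((Finset.measurable_sum _ fun i _ => hh.comp (measurable_pi_apply i).snd).const_mul _).ennreal_ofReal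
  have hN : ENNReal.ofReal (((N : ℝ) + 1)⁻¹) * ((N + 1 : ℕ) : ℝ≥0∞) = 1 := by
    rw [ENNReal.ofReal_inv_of_pos (by positivity)]
    have : ENNReal.ofReal ((N : ℝ) + 1) = ((N + 1 : ℕ) : ℝ≥0∞) := by
      rw [show ((N : ℝ) + 1) = ((N + 1 : ℕ) : ℝ) by push_cast; ring, ENNReal.ofReal_natCast]
    rw [this]
    exact ENNReal.inv_mul_cancel (by simp) (ENNReal.natCast_ne_top _)
  calc ∫⁻ z, ENNReal.ofReal (((N : ℝ) + 1)⁻¹ * ∑ i : Fin (N + 1), h ((Φ.flow r z i).2))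
        ∂(localGibbsLaw σ (fun _ => a) (fun _ => u) (fun _ => θb) N Φ)
      = ∫⁻ z, g (Φ.flow r z) ∂(localGibbsLaw σ (fun _ => a) (fun _ => u) (fun _ => θb) N Φ) := rfl
    _ = ∫⁻ z, g z ∂(localGibbsLaw σ (fun _ => a) (fun _ => u) (fun _ => θb) N Φ) :=
        Summit.AtomisticToContinuum.HydrodynamicLimit.Theorems.lintegral_comp_flow_localGibbsLaw_const
          σ a θb u N Φ r hgm
    _ = ∫⁻ z, ENNReal.ofReal (((N : ℝ) + 1)⁻¹) * ∑ i : Fin (N + 1), ENNReal.ofReal (h ((z i).2))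
          ∂(localGibbsLaw σ (fun _ => a) (fun _ => u) (fun _ => θb) N Φ) :=
        lintegral_congr fun z => hpt z
    _ = ENNReal.ofReal (((N : ℝ) + 1)⁻¹) *
          ∑ i : Fin (N + 1), ∫⁻ z, ENNReal.ofReal (h ((z i).2))
            ∂(localGibbsLaw σ (fun _ => a) (fun _ => u) (fun _ => θb) N Φ) := by
        rw [lintegral_const_mul _ (Finset.measurable_sum _ fun i _ => hvel i),
          lintegral_finsetSum _ fun i _ => hvel i]
    _ = ENNReal.ofReal (((N : ℝ) + 1)⁻¹) *
          ∑ _i : Fin (N + 1), ∫⁻ w, ENNReal.ofReal (h w) ∂(gaussMeasure u θb) := by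
        congr 1
        refine Finset.sum_congr rfl fun i _ => ?_
        exact lintegral_vel_localGibbsLaw_drift hσ ha hθ u N Φ i hg
    _ = ∫⁻ w, ENNReal.ofReal (h w) ∂(gaussMeasure u θb) := by
        rw [Finset.sum_const, Finset.card_univ, Fintype.card_fin, nsmul_eq_mul, ← mul_assoc, hN,
          one_mul]


/-! ### Gaussian moments: finite and positive -/

/-- `E‖w‖ᵏ < ∞` under a drifted Gaussian. [folklore] -/
theorem lintegral_norm_pow_gaussMeasure_ne_top (u : V3) (θ : ℝ) {k : ℕ} (hk : k ≠ 0) :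
    ∫⁻ w, ENNReal.ofReal (‖w‖ ^ k) ∂(gaussMeasure u θ) ≠ ⊤ := by
  have hk' : Integrable (fun v : V3 => ‖v‖ ^ k) (gaussMeasure u θ) := by
    have := (ProbabilityTheory.IsGaussian.memLp_id (gaussMeasure u θ) ((k : ℕ) : ℝ≥0∞)
      (by simp)).integrable_norm_pow (by exact_mod_cast hk)
    simpa using this
  exact hk'.lintegral_lt_top.ne

/-- `E‖w‖ᵏ > 0` under a non-degenerate drifted Gaussian (`θ > 0`): the integrand is positive off
the origin, a Lebesgue-conull set, and the Gaussian has an everywhere positive density. [folklore] -/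
theorem lintegral_norm_pow_gaussMeasure_ne_zero (u : V3) {θ : ℝ} (hθ : 0 < θ) (k : ℕ) :
    ∫⁻ w, ENNReal.ofReal (‖w‖ ^ k) ∂(gaussMeasure u θ) ≠ 0 := by
  have hM : Measurable fun v : V3 => ENNReal.ofReal (localMaxwellian 1 θ u v) :=
    (continuous_localMaxwellian 1 θ u).measurable.ennreal_ofReal
  have hg : Measurable fun w : V3 => ENNReal.ofReal (‖w‖ ^ k) :=
    (measurable_norm.pow_const k).ennreal_ofReal
  rw [← withDensity_localMaxwellian_eq_gaussMeasure hθ u, lintegral_withDensity_eq_lintegral_mul _ hM hg]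
  intro h0
  have hae := (lintegral_eq_zero_iff (hM.mul hg)).1 h0
  -- the integrand vanishes only at the origin
  have hsub : {w : V3 | w ≠ 0} ⊆ {w : V3 | (fun v => ENNReal.ofReal (localMaxwellian 1 θ u v) *
      ENNReal.ofReal (‖v‖ ^ k)) w ≠ (0 : V3 → ℝ≥0∞) w} := by
    intro w hw
    simp only [Set.mem_setOf_eq, Pi.zero_apply]
    refine mul_ne_zero ?_ ?_
    · exact (ENNReal.ofReal_pos.2 (localMaxwellian_pos one_pos hθ u w)).ne'
    · exact (ENNReal.ofReal_pos.2 (pow_pos (norm_pos_iff.2 hw) k)).ne'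
  have hnull : volume {w : V3 | w ≠ 0} = 0 :=
    measure_mono_null hsub (ae_iff.1 hae)
  have huniv : (volume : Measure V3) Set.univ = 0 := by
    have : (Set.univ : Set V3) = {w : V3 | w ≠ 0} ∪ {0} := by
      ext w; by_cases hw : w = 0 <;> simp [hw]
    rw [this]
    exact measure_union_null hnull (measure_singleton _)
  exact (NeZero.ne (volume : Measure V3) ) (Measure.measure_univ_eq_zero.1 huniv)

/-! ### Pathwise: the pre-collisional energy mark is dominated by the post-collisional `b₄` -/

/-- `x y ≤ (x + y)²/4` applied to squared speeds with pair energy conservation: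
`‖v⁻‖²‖w⁻‖² ≤ (‖v⁺‖²+‖w⁺‖²)²/4`. [folklore] -/
theorem normSq_mul_le_of_sq_eq {x₁ x₂ y₁ y₂ : ℝ} (h : y₁ ^ 2 + y₂ ^ 2 = x₁ ^ 2 + x₂ ^ 2) :
    y₁ ^ 2 * y₂ ^ 2 ≤ (x₁ ^ 2 + x₂ ^ 2) ^ 2 / 4 := by
  rw [← h]; nlinarith [sq_nonneg (y₁ ^ 2 - y₂ ^ 2)]

/-- **Pathwise domination of the pre-collisional energy flux.**  On a good orbit, for `s ≤ s′`,
`Σ_{ordered records in (s,s′]} ‖v₁⁻‖²‖v₂⁻‖² ≤` the collision pair sum of `b₄(vᵢ,vⱼ) = (‖vᵢ‖²+‖vⱼ‖²)²/4`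
(post-collisional) over `[0, s′−s]` along the orbit of `Φ_s z`. [folklore] -/
theorem ofReal_energyFluxSum_le_collisionPairSum {d X : Type*} [Fintype d] [MeasureSpace X]
    [TopologicalSpace X] {G : Geometry d X} {ε : ℝ} {n : ℕ} (Φ : HardSphereFlow G ε n)
    {z : Config n d X} (hz : z ∈ Φ.good) {s s' : ℝ} (hss' : s ≤ s') :
    ENNReal.ofReal (Φ.collisionSum (Ioc s s')
        (fun col => ‖col.preVel.1‖ ^ 2 * ‖col.preVel.2‖ ^ 2) z) ≤
      Φ.collisionPairSum (Icc 0 (s' - s))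
        (fun _ w i j => ENNReal.ofReal ((‖(w i).2‖ ^ 2 + ‖(w j).2‖ ^ 2) ^ 2 / 4)) (Φ.flow s z) := by
  have _ := hss'
  rw [HardSphereFlow.collisionSum_eq, collisionSum_eq_collisionPairSum]
  set γ : ℝ → Config n d X := fun r => Φ.flow r z with hγ
  have hγt : IsHardSphereTrajectory G ε n γ := Φ.isTrajectory z hz
  have hfin1 : (collisionTimes G ε γ ∩ Ioc s s').Finite :=
    hγt.finite_collisionTimes_inter_of_subset_Icc Ioc_subset_Icc_self
  have hfin2 : (collisionTimes G ε γ ∩ Icc s (s + (s' - s))).Finite := hγt.locFinite s (s + (s' - s))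
  set m : ℝ → Fin n → Fin n → ℝ := fun t i j => (‖(γ t i).2‖ ^ 2 + ‖(γ t j).2‖ ^ 2) ^ 2 / 4
    with hm
  have hm0 : ∀ t i j, 0 ≤ m t i j := fun t i j => by rw [hm]; positivity
  have h1 : collisionPairSum G ε γ (Ioc s s')
      (fun t i j => (fun col : HardSphereCollisionRecord d X n =>
        ‖col.preVel.1‖ ^ 2 * ‖col.preVel.2‖ ^ 2)
        (HardSphereCollisionRecord.ofConfig G ε (γ t) t i j)) ≤
      collisionPairSum G ε γ (Ioc s s') m :=
    collisionPairSum_mono hfin1 fun t _ p _ =>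
      normSq_mul_le_of_sq_eq (HardSphereCollisionRecord.ofConfig_norm_sq_preVel G ε (γ t) t p.1 p.2)
  have h2 : collisionPairSum G ε γ (Ioc s s') m ≤ collisionPairSum G ε γ (Icc s (s + (s' - s))) m := by
    rw [collisionPairSum_eq_finset_sum hfin1, collisionPairSum_eq_finset_sum hfin2]
    refine Finset.sum_le_sum_of_subset_of_nonneg (fun t ht => ?_)
      (fun t _ _ => Finset.sum_nonneg fun p _ => hm0 t p.1 p.2)
    rw [Set.Finite.mem_toFinset] at ht ⊢
    exact ⟨ht.1, (Ioc_subset_Icc_self.trans (Icc_subset_Icc_right (by linarith))) ht.2⟩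
  have h3 : ENNReal.ofReal (collisionPairSum G ε γ (Icc s (s + (s' - s))) m) =
      collisionPairSum G ε γ (Icc s (s + (s' - s))) (fun t i j => ENNReal.ofReal (m t i j)) := by
    rw [collisionPairSum_eq_finset_sum hfin2, collisionPairSum_eq_finset_sum hfin2,
      ENNReal.ofReal_sum_of_nonneg fun t _ => Finset.sum_nonneg fun p _ => hm0 t p.1 p.2]
    exact Finset.sum_congr rfl fun t _ => ENNReal.ofReal_sum_of_nonneg fun p _ => hm0 t p.1 p.2
  have hfa : ∀ r, Φ.flow r (Φ.flow s z) = γ (r + s) := fun r => (Φ.flow_add r s z hz).symm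
  have h4 : collisionPairSum G ε γ (Icc s (s + (s' - s))) (fun t i j => ENNReal.ofReal (m t i j)) =
      Φ.collisionPairSum (Icc 0 (s' - s))
        (fun _ w i j => ENNReal.ofReal ((‖(w i).2‖ ^ 2 + ‖(w j).2‖ ^ 2) ^ 2 / 4)) (Φ.flow s z) := by
    unfold HardSphereFlow.collisionPairSum
    simp only [hfa]
    unfold collisionPairSum
    symm
    refine finsum_mem_eq_of_bijOn (fun r => r + s) ⟨?_, ?_, ?_⟩ fun r _ => rfl
    · rintro r ⟨hr, h0, hrh⟩
      exact ⟨hr, by linarith, by linarith⟩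
    · exact fun r _ r' _ hrr' => by simpa using hrr'
    · rintro t ⟨ht, hts, hth⟩
      refine ⟨t - s, ⟨?_, by linarith, by linarith⟩, sub_add_cancel t s⟩
      show t - s + s ∈ collisionTimes G ε γ
      rwa [sub_add_cancel]
  calc ENNReal.ofReal _ ≤ ENNReal.ofReal (collisionPairSum G ε γ (Icc s (s + (s' - s))) m) :=
        ENNReal.ofReal_le_ofReal (h1.trans h2)
    _ = _ := h3
    _ = _ := h4

/-! ### The certificate -/

/-- **Audit stub `stub_energyFluxCeilingRung0` — S2a at rung 0 (global equilibrium with drift),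
uniformly in `N ≥ 1` and in the window.**  For constant profiles `a, θ̄ > 0`, any constant drift `u`,
there is `σ₀ > 0` (small reduced density of `posGibbs_pairEvent_le`) such that for `0 < σ < σ₀` and every
flow family `Φ` there is `K ≥ 0` — explicitly
`K = 16 ∫‖w−v‖(‖v‖²+‖w‖²)²/4 dN(u,θ̄)^{⊗2} / (E‖w‖²·E‖w‖³)` — with, for all `N ≥ 1` and all `s ≤ s′`,
`∫ (N+1)⁻¹Σ_{ordered records in (s,s′]} ‖v₁⁻‖²‖v₂⁻‖² dG_N ≤ K σ²(N+1)^{1/3}(s′−s) · sup_{[s,s′]} m₂ · sup_{[s,s′]} m₃`: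
the conclusion of S2a `stub_energyFluxCeiling` at constant profiles (there `s′ ≤ s + τ(N+1)^{-1/3}` is
not even needed). [folklore] -/
theorem stub_energyFluxCeilingRung0 : ∀ (a θb : ℝ) (u : V3), 0 < a → 0 < θb →
    ∃ σ₀ : ℝ, 0 < σ₀ ∧ ∀ σ : ℝ, 0 < σ → σ < σ₀ →
      ∀ (Φ : (N : ℕ) → HardSphereFlow (Torus.geometry (Fin 3)) (hsDiameter σ N) (N + 1)),
        ∃ K : ℝ, 0 ≤ K ∧ ∃ N₀ : ℕ, ∀ N : ℕ, N₀ ≤ N → ∀ s s' : ℝ, s ≤ s' →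
          (∫⁻ z, ENNReal.ofReal (((N : ℝ) + 1)⁻¹ * (Φ N).collisionSum (Set.Ioc s s')
              (fun col => ‖col.preVel.1‖ ^ 2 * ‖col.preVel.2‖ ^ 2) z)
            ∂(localGibbsLaw σ (fun _ => a) (fun _ => u) (fun _ => θb) N (Φ N))) ≤
            ENNReal.ofReal (K * (σ ^ 2 * ((N : ℝ) + 1) ^ (1 / 3 : ℝ) * (s' - s))) *
              (⨆ r ∈ Set.Icc s s', (∫⁻ z, ENNReal.ofReal (((N : ℝ) + 1)⁻¹ *
                  ∑ i : Fin (N + 1), ‖((Φ N).flow r z i).2‖ ^ 2)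
                ∂(localGibbsLaw σ (fun _ => a) (fun _ => u) (fun _ => θb) N (Φ N)))) *
              (⨆ r ∈ Set.Icc s s', (∫⁻ z, ENNReal.ofReal (((N : ℝ) + 1)⁻¹ *
                  ∑ i : Fin (N + 1), ‖((Φ N).flow r z i).2‖ ^ 3)
                ∂(localGibbsLaw σ (fun _ => a) (fun _ => u) (fun _ => θb) N (Φ N)))) := by
  intro a θb u ha hθ
  obtain ⟨σ₀, hσ₀, hsmall⟩ := exists_smallDensity uniformProfile one_pos
  refine ⟨σ₀, hσ₀, fun σ hσ hσlt Φ => ?_⟩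
  have hsm : SmallDensity uniformProfile σ := (hsmall σ hσ hσlt).1
  have hσ2 : σ ≤ 1 / 2 := hsm.σ_lt_half.le
  -- the post-collisional mark and its Gaussian flux moment
  set A : V3 × V3 → ℝ≥0∞ := fun p => ENNReal.ofReal ((‖p.1‖ ^ 2 + ‖p.2‖ ^ 2) ^ 2 / 4) with hA
  have hAm : Measurable A := by rw [hA]; fun_prop
  set I : ℝ≥0∞ := ∫⁻ p, ENNReal.ofReal ‖p.2 - p.1‖ * A p
    ∂((gaussMeasure u θb).prod (gaussMeasure u θb)) with hI
  have hItop : I ≠ ⊤ := lintegral_fluxQuartic_ne_top u θb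
  set E2 : ℝ≥0∞ := ∫⁻ w, ENNReal.ofReal (‖w‖ ^ 2) ∂(gaussMeasure u θb) with hE2
  set E3 : ℝ≥0∞ := ∫⁻ w, ENNReal.ofReal (‖w‖ ^ 3) ∂(gaussMeasure u θb) with hE3
  have hE2top : E2 ≠ ⊤ := lintegral_norm_pow_gaussMeasure_ne_top u θb (k := 2) (by norm_num)
  have hE3top : E3 ≠ ⊤ := lintegral_norm_pow_gaussMeasure_ne_top u θb (k := 3) (by norm_num)
  have hE2pos : E2 ≠ 0 := lintegral_norm_pow_gaussMeasure_ne_zero u hθ 2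
  have hE3pos : E3 ≠ 0 := lintegral_norm_pow_gaussMeasure_ne_zero u hθ 3
  have hE2r : 0 < E2.toReal := ENNReal.toReal_pos hE2pos hE2top
  have hE3r : 0 < E3.toReal := ENNReal.toReal_pos hE3pos hE3top
  set K : ℝ := 16 * I.toReal / (E2.toReal * E3.toReal) with hK
  have hK0 : 0 ≤ K := by rw [hK]; positivity
  refine ⟨K, hK0, 1, fun N hN s s' hss' => ?_⟩
  set P := localGibbsLaw σ (fun _ => a) (fun _ => u) (fun _ => θb) N (Φ N) with hP
  set h : ℝ := s' - s with hhdef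
  have hh0 : 0 ≤ h := by rw [hhdef]; linarith
  -- the moments are constant: `sup m₂ ≥ m₂(s) = E2`, `sup m₃ ≥ m₃(s) = E3`
  have hm2 : E2 ≤ ⨆ r ∈ Set.Icc s s', (∫⁻ z, ENNReal.ofReal (((N : ℝ) + 1)⁻¹ *
      ∑ i : Fin (N + 1), ‖((Φ N).flow r z i).2‖ ^ 2) ∂P) := by
    have heq := avgMoment_flow_localGibbsLaw_drift hσ2 ha hθ u N (Φ N) s
      (h := fun w : V3 => ‖w‖ ^ 2) (measurable_norm.pow_const 2) (fun w => by positivity)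
    rw [hE2, ← heq]
    exact le_iSup₂ (f := fun r (_ : r ∈ Set.Icc s s') => ∫⁻ z, ENNReal.ofReal (((N : ℝ) + 1)⁻¹ *
      ∑ i : Fin (N + 1), ‖((Φ N).flow r z i).2‖ ^ 2) ∂P) s ⟨le_rfl, hss'⟩
  have hm3 : E3 ≤ ⨆ r ∈ Set.Icc s s', (∫⁻ z, ENNReal.ofReal (((N : ℝ) + 1)⁻¹ *
      ∑ i : Fin (N + 1), ‖((Φ N).flow r z i).2‖ ^ 3) ∂P) := by
    have heq := avgMoment_flow_localGibbsLaw_drift hσ2 ha hθ u N (Φ N) s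
      (h := fun w : V3 => ‖w‖ ^ 3) (measurable_norm.pow_const 3) (fun w => by positivity)
    rw [hE3, ← heq]
    exact le_iSup₂ (f := fun r (_ : r ∈ Set.Icc s s') => ∫⁻ z, ENNReal.ofReal (((N : ℝ) + 1)⁻¹ *
      ∑ i : Fin (N + 1), ‖((Φ N).flow r z i).2‖ ^ 3) ∂P) s ⟨le_rfl, hss'⟩
  -- degenerate window
  rcases hh0.eq_or_lt with hzero | hhpos
  · have hs : s' = s := by rw [hhdef] at hzero; linarith
    have hempty : ∀ z, (Φ N).collisionSum (Set.Ioc s s')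
        (fun col => ‖col.preVel.1‖ ^ 2 * ‖col.preVel.2‖ ^ 2) z = 0 := by
      intro z
      rw [HardSphereFlow.collisionSum_eq, collisionSum_eq_collisionPairSum, hs, Set.Ioc_self]
      exact collisionPairSum_empty _ _
    have hL : (∫⁻ z, ENNReal.ofReal (((N : ℝ) + 1)⁻¹ * (Φ N).collisionSum (Set.Ioc s s')
        (fun col => ‖col.preVel.1‖ ^ 2 * ‖col.preVel.2‖ ^ 2) z) ∂P) = 0 := by
      rw [lintegral_congr (g := fun _ => 0) fun z => by rw [hempty z, mul_zero, ENNReal.ofReal_zero],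
        lintegral_zero]
    rw [hL]
    exact bot_le
  -- the flux engine on the window `[0, h]` along the orbit of `Φ_s z`
  have hc : (0 : ℝ) ≤ ((N : ℝ) + 1)⁻¹ := by positivity
  have hflux := localGibbsLaw_lintegral_le_of_le_collisionMarkSum hσ2 ha hθ u (Φ N)
    (measurePreserving_flow_localGibbsLaw_const σ a θb u N (Φ N))
    (fun i j hij T hT => posGibbs_pairEvent_le hsm hN hij hT)
    (fun h hh => exists_sweptTube (hsDiameter_pos hσ N) hh)
    (fun S hS => by simpa only [sub_zero] using volume_setOf_exists_reprSym_add_latticeVec_mem_le 0 hS)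
    hhpos hAm s (fun z hz => ofReal_energyFluxSum_le_collisionPairSum (Φ N) hz hss')
  -- constants: `(N+1)⁻¹ · 16 h (N+1)² ε² = 16 σ² (N+1)^{1/3} h`
  have hn1 : (0 : ℝ) < (N : ℝ) + 1 := by positivity
  have hx13 : ((N : ℝ) + 1) * (((N : ℝ) + 1) ^ (-(1 / 3 : ℝ))) ^ 2 = ((N : ℝ) + 1) ^ (1 / 3 : ℝ) := by
    -- `x · (x^{-1/3})² = x^{1 - 2/3} = x^{1/3}`
    rw [← Real.rpow_natCast (((N : ℝ) + 1) ^ (-(1 / 3 : ℝ))) 2, ← Real.rpow_mul hn1.le]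
    conv_lhs => rw [show ((N : ℝ) + 1) = ((N : ℝ) + 1) ^ (1 : ℝ) from (Real.rpow_one _).symm]
    rw [← Real.rpow_mul hn1.le, ← Real.rpow_add hn1]
    norm_num
  have hgeom : ((N : ℝ) + 1)⁻¹ * (16 * h * ((N + 1 : ℕ) : ℝ) ^ 2 * hsDiameter σ N ^ 2) =
      16 * (σ ^ 2 * ((N : ℝ) + 1) ^ (1 / 3 : ℝ) * h) := by
    rw [hsDiameter, ← hx13]
    push_cast
    field_simp
  -- the real identity `K σ²(N+1)^{1/3} h · E2 · E3 = 16 σ²(N+1)^{1/3} h · I`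
  have hKI : K * (σ ^ 2 * ((N : ℝ) + 1) ^ (1 / 3 : ℝ) * h) * E2.toReal * E3.toReal =
      16 * (σ ^ 2 * ((N : ℝ) + 1) ^ (1 / 3 : ℝ) * h) * I.toReal := by
    rw [hK]
    field_simp
  have hIeq : I = ENNReal.ofReal I.toReal := (ENNReal.ofReal_toReal hItop).symm
  have hE2eq : E2 = ENNReal.ofReal E2.toReal := (ENNReal.ofReal_toReal hE2top).symm
  have hE3eq : E3 = ENNReal.ofReal E3.toReal := (ENNReal.ofReal_toReal hE3top).symm
  have hcoef : 0 ≤ σ ^ 2 * ((N : ℝ) + 1) ^ (1 / 3 : ℝ) * h := by positivity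
  -- assemble
  have hsplit : (∫⁻ z, ENNReal.ofReal (((N : ℝ) + 1)⁻¹ * (Φ N).collisionSum (Set.Ioc s s')
        (fun col => ‖col.preVel.1‖ ^ 2 * ‖col.preVel.2‖ ^ 2) z) ∂P) =
      ENNReal.ofReal ((N : ℝ) + 1)⁻¹ * ∫⁻ z, ENNReal.ofReal ((Φ N).collisionSum (Set.Ioc s s')
        (fun col => ‖col.preVel.1‖ ^ 2 * ‖col.preVel.2‖ ^ 2) z) ∂P := by
    rw [← lintegral_const_mul' _ _ ENNReal.ofReal_ne_top]
    exact lintegral_congr fun z => ENNReal.ofReal_mul hc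
  rw [hsplit]
  calc ENNReal.ofReal ((N : ℝ) + 1)⁻¹ * _
      ≤ ENNReal.ofReal ((N : ℝ) + 1)⁻¹ *
          (ENNReal.ofReal (16 * h * ((N + 1 : ℕ) : ℝ) ^ 2 * hsDiameter σ N ^ 2) * I) := by gcongr
    _ = ENNReal.ofReal (((N : ℝ) + 1)⁻¹ * (16 * h * ((N + 1 : ℕ) : ℝ) ^ 2 * hsDiameter σ N ^ 2) *
          I.toReal) := by
        rw [hIeq, ENNReal.toReal_ofReal ENNReal.toReal_nonneg, ← mul_assoc, ← ENNReal.ofReal_mul hc,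
          ← ENNReal.ofReal_mul (by positivity)]
    _ = ENNReal.ofReal (K * (σ ^ 2 * ((N : ℝ) + 1) ^ (1 / 3 : ℝ) * h) * E2.toReal * E3.toReal) := by
        rw [hgeom, hKI]
    _ = ENNReal.ofReal (K * (σ ^ 2 * ((N : ℝ) + 1) ^ (1 / 3 : ℝ) * h)) * E2 * E3 := by
        rw [ENNReal.ofReal_mul (by positivity), ENNReal.ofReal_mul (by positivity), ← hE2eq, ← hE3eq]
    _ ≤ _ := by gcongr

end Summit.AtomisticToContinuum.HydrodynamicLimit.Theorems.QuarticSchurLedger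

end
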